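import Mathlib

/-!
# Crux-triage r1-1, crux `FarPastLedger` (stmt-NavierStokesRegularity-14060):
# the cut-off hypotheses of `Ideator2.LedgerFluxLinearisation` are jointly unsatisfiable

Card `one-scale-gronwall-ledger`, first lemma `LedgerFluxLinearisation`
(`Cruxes/FarPastLedger/Ideator2Sketch.lean`) quantifies over cut-offs `φ` with
`ContDiff ℝ ⊤ φ`, `φ = 1` on `ball b R`, `φ = 0` off `ball b (2R)` and `‖fderiv ℝ φ x‖ ≤ 1/R`
for ALL `x`.  No `C¹` function has these properties (along a ray the profile would have to drop
by `1` over length `R` at slope `≤ 1/R`, i.e. be the affine ramp, whose one-sided derivatives at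
`r = R` are `0` and `-1/R`).  Hence the lemma as typed is VACUOUSLY true and cannot be
instantiated in the composition `LedgerFromOscillation`; fix: `‖fderiv ℝ φ x‖ ≤ 2/R`,
`|Δφ x| ≤ 12/R²` (a radial profile exists), or quantify `∃ c₁ c₂` absolute.

The 1-D core is proved below (`no_sharp_ramp`), then the reduction along a ray
(`no_sharp_cutoff`).
-/

open Set Metric

/-- 1-D core: a differentiable `g` with `g = 1` on `[0, R)`, `g (2R) = 0` and `|g'| ≤ 1/R`
everywhere does not exist (`R > 0`). -/
theorem no_sharp_ramp {R : ℝ} (hR : 0 < R) (g : ℝ → ℝ) (hg : Differentiable ℝ g)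
    (h1 : ∀ r ∈ Ico 0 R, g r = 1) (h0 : g (2 * R) = 0)
    (hder : ∀ r, |deriv g r| ≤ 1 / R) : False := by
  have hcont : Continuous g := hg.continuous
  -- g R = 1 by continuity from the left
  have hgR : g R = 1 := by
    have hclosed : IsClosed {r | g r = 1} := isClosed_eq hcont continuous_const
    have hsub : Ioo 0 R ⊆ {r | g r = 1} := fun r hr => h1 r ⟨hr.1.le, hr.2⟩
    have hcl : closure (Ioo 0 R) ⊆ {r | g r = 1} := hclosed.closure_subset_iff.2 hsub
    have : R ∈ closure (Ioo (0:ℝ) R) := by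
      rw [closure_Ioo hR.ne]; exact ⟨hR.le, le_rfl⟩
    exact hcl this
  -- g = 1 on Icc 0 R
  have h1' : ∀ r ∈ Icc 0 R, g r = 1 := by
    intro r hr
    rcases lt_or_eq_of_le hr.2 with h | h
    · exact h1 r ⟨hr.1, h⟩
    · rw [h]; exact hgR
  -- left derivative at R is 0
  have hd0 : deriv g R = 0 := by
    have hU : UniqueDiffWithinAt ℝ (Icc 0 R) R :=
      uniqueDiffOn_Icc hR R ⟨hR.le, le_rfl⟩
    have hA : HasDerivWithinAt g (deriv g R) (Icc 0 R) R :=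
      (hg R).hasDerivAt.hasDerivWithinAt
    have hB : HasDerivWithinAt g 0 (Icc 0 R) R := by
      have hc : HasDerivWithinAt (fun _ : ℝ => (1:ℝ)) 0 (Icc 0 R) R := hasDerivWithinAt_const _ _ _
      exact hc.congr (fun r hr => h1' r hr) (h1' R ⟨hR.le, le_rfl⟩)
    exact hU.eq_deriv _ hA hB
  -- h r := g r + (r - R)/R is monotone on [R, 2R]
  set h : ℝ → ℝ := fun r => g r + (r - R) / R with hh
  have hdiffh : Differentiable ℝ h := by
    refine hg.add ?_
    exact (differentiable_id.sub_const R).div_const R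
  have hderivh : ∀ r, deriv h r = deriv g r + 1 / R := by
    intro r
    have h2 : HasDerivAt (fun r : ℝ => (r - R) / R) (1 / R) r := by
      have := ((hasDerivAt_id r).sub_const R).div_const R
      simpa using this
    have := ((hg r).hasDerivAt.add h2)
    exact this.deriv
  have hmono : MonotoneOn h (Icc R (2 * R)) := by
    refine monotoneOn_of_deriv_nonneg (convex_Icc R (2 * R)) hdiffh.continuous.continuousOn
      (hdiffh.differentiableOn.mono interior_subset) ?_
    intro r _
    rw [hderivh]
    have := hder r
    have h3 : -(1 / R) ≤ deriv g r := by
      have := abs_le.1 this; exact this.1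
    linarith
  have hhR : h R = 1 := by simp [hh, hgR]
  have hh2R : h (2 * R) = 1 := by
    simp only [hh, h0, zero_add]
    field_simp
    ring
  -- hence h ≡ 1 on [R, 2R], i.e. g r = 1 - (r - R)/R there
  have hconst : ∀ r ∈ Icc R (2 * R), g r = 1 - (r - R) / R := by
    intro r hr
    have hRmem : R ∈ Icc R (2 * R) := ⟨le_rfl, by linarith⟩
    have h2Rmem : 2 * R ∈ Icc R (2 * R) := ⟨by linarith, le_rfl⟩
    have ha : h R ≤ h r := hmono hRmem hr hr.1
    have hb : h r ≤ h (2 * R) := hmono hr h2Rmem hr.2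
    have : h r = 1 := le_antisymm (hh2R ▸ hb) (hhR ▸ ha)
    have : g r + (r - R) / R = 1 := this
    linarith
  -- right derivative at R is -1/R
  have hd1 : deriv g R = -(1 / R) := by
    have h2R : R < 2 * R := by linarith
    have hU : UniqueDiffWithinAt ℝ (Icc R (2 * R)) R :=
      uniqueDiffOn_Icc h2R R ⟨le_rfl, h2R.le⟩
    have hA : HasDerivWithinAt g (deriv g R) (Icc R (2 * R)) R :=
      (hg R).hasDerivAt.hasDerivWithinAt
    have hB : HasDerivWithinAt g (-(1 / R)) (Icc R (2 * R)) R := by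
      have hc : HasDerivAt (fun r : ℝ => 1 - (r - R) / R) (-(1 / R)) R := by
        have := (((hasDerivAt_id R).sub_const R).div_const R).const_sub 1
        simpa using this
      exact hc.hasDerivWithinAt.congr (fun r hr => hconst r hr) (hconst R ⟨le_rfl, h2R.le⟩)
    exact hU.eq_deriv _ hA hB
  rw [hd0] at hd1
  have : (1 : ℝ) / R = 0 := by linarith
  exact absurd this (one_div_pos.2 hR).ne'

abbrev E3 := EuclideanSpace ℝ (Fin 3)

/-- The cut-off hypotheses of `LedgerFluxLinearisation` (card one-scale-gronwall-ledger) are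
unsatisfiable: there is no `C¹` (a fortiori `C^∞`) `φ` with `φ = 1` on `ball b R`, `φ = 0` off
`ball b (2R)` and `‖fderiv ℝ φ x‖ ≤ 1/R` everywhere. -/
theorem no_sharp_cutoff {R : ℝ} (hR : 0 < R) (b : E3) (φ : E3 → ℝ)
    (hφ : ContDiff ℝ (⊤ : ℕ∞) φ) (hout : ∀ x ∉ ball b (2 * R), φ x = 0)
    (hin : ∀ x ∈ ball b R, φ x = 1) (hgrad : ∀ x, ‖fderiv ℝ φ x‖ ≤ 1 / R) : False := by
  -- a unit vector
  set ω : E3 := EuclideanSpace.single (0 : Fin 3) (1 : ℝ) with hω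
  have hωn : ‖ω‖ = 1 := by
    rw [hω]; simp
  -- the ray profile
  set γ : ℝ → E3 := fun r => b + r • ω with hγ
  set g : ℝ → ℝ := fun r => φ (γ r) with hg
  have hφd : Differentiable ℝ φ := hφ.differentiable (by simp)
  have hγd : ∀ r, HasDerivAt γ ω r := by
    intro r
    have := ((hasDerivAt_id r).smul_const ω).const_add b
    simpa [hγ] using this
  have hgd' : ∀ r, HasDerivAt g (fderiv ℝ φ (γ r) ω) r := by
    intro r
    exact (hφd (γ r)).hasFDerivAt.comp_hasDerivAt r (hγd r)
  have hgd : Differentiable ℝ g := fun r => (hgd' r).differentiableAt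
  refine no_sharp_ramp hR g hgd ?_ ?_ ?_
  · intro r hr
    apply hin
    rw [mem_ball, hγ]
    simp only [dist_self_add_left, norm_smul, Real.norm_eq_abs, hωn, mul_one]
    rw [abs_of_nonneg hr.1]; exact hr.2
  · apply hout
    rw [mem_ball, hγ]
    simp only [dist_self_add_left, norm_smul, Real.norm_eq_abs, hωn, mul_one, not_lt]
    rw [abs_of_nonneg (by linarith)]
  · intro r
    rw [(hgd' r).deriv]
    calc |(fderiv ℝ φ (γ r)) ω| = ‖(fderiv ℝ φ (γ r)) ω‖ := (Real.norm_eq_abs _).symm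
      _ ≤ ‖fderiv ℝ φ (γ r)‖ * ‖ω‖ := ContinuousLinearMap.le_opNorm _ _
      _ ≤ 1 / R * 1 := by rw [hωn]; exact mul_le_mul_of_nonneg_right (hgrad _) zero_le_one
      _ = 1 / R := mul_one _
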